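import Mathlib.Analysis.SpecialFunctions.Complex.Arg
import Mathlib.Analysis.SpecialFunctions.Complex.Circle
import Mathlib.Topology.Algebra.Constructions
import Literature.AlgebraicGeometry.Frobenioids.ArchimedeanData
import HarnessLib

/-!
# Frobenioids II, Definition 3.1 (iii) / Example 3.3 (v): the unit circle inside `ℂ^×` and slit regions

Mochizuki, *The geometry of Frobenioids II: poly-Frobenioids*, Kyushu J. Math. **62** (2008)
401–460, §3: Definition 3.1 (iii) p. 24 (an angular region `A = B × (0, λ]` with `B ⊆ O_K^×` open and
meeting every connected component of `O_K^×` in a nonempty connected set) and Example 3.3 (v) p. 29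
(an object "whose angular region is determined by the complement in `S¹` of a single element of `S¹`"
— a *slit* region) [cite: MochizukiFrdII2008, Ex 3.3 (v) p.29].

abc-iut-L1-t4's `ArchFrd.AngularRegion K` records the angular part as a subset of
`normOneSubgroup K ⊆ Kˣ` (units of norm `1`) with the printed openness / connectedness conditions.
This file supplies the topology of `O_ℂ^× = S¹ ⊆ ℂ^×` needed to EXHIBIT non-isotropic regions:
the parametrisation `θ ↦ e^{iθ}` (`ArchFrd.expUnit`, continuous and surjective), the connectedness of
`normOneSubgroup ℂ`, the arc `S¹ ∖ {−1} = expUnit '' (−π, π)`, and the **slit region**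
`ArchFrd.slitRegion t` of tip `t` with angular part `S¹ ∖ {−1}` (an `AngularRegion`, i.e. open with
connected nonempty trace on the unique connected component), which is NOT isotropic. Consumers: the
slit morphisms of Ex. 3.3 (v) (abc-iut-L1-t6) and abc-iut-L1-t9's witness for Thm. 3.6 (iv).
-/

namespace Literature.AlgebraicGeometry.Frobenioids

open Complex Topology

noncomputable section

namespace ArchFrd

/-! ### The parametrisation `θ ↦ e^{iθ}` of `O_ℂ^× ⊆ ℂ^×` -/

/-- `e^{iθ}` as a unit of `ℂ`. [cite: MochizukiFrdII2008, Def 3.1 (ii) p.23] -/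
def expUnits (θ : ℝ) : ℂˣ := Units.mk0 (exp (θ * I)) (exp_ne_zero _)

/-- The value of `expUnits`. [cite: MochizukiFrdII2008, Def 3.1 (ii) p.23] -/
@[simp] theorem coe_expUnits (θ : ℝ) : (expUnits θ : ℂ) = exp (θ * I) := rfl

/-- `e^{iθ}` has norm `1`, i.e. lies in `O_ℂ^×`. [cite: MochizukiFrdII2008, Def 3.1 (ii) p.23] -/
theorem expUnits_mem (θ : ℝ) : expUnits θ ∈ normOneSubgroup ℂ := by
  rw [mem_normOneSubgroup_iff, coe_expUnits]
  exact norm_exp_ofReal_mul_I θ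

/-- `e^{iθ}` as an element of `O_ℂ^× = S¹`. [cite: MochizukiFrdII2008, Def 3.1 (ii) p.23] -/
def expUnit (θ : ℝ) : normOneSubgroup ℂ := ⟨expUnits θ, expUnits_mem θ⟩

/-- The value of `expUnit`. [cite: MochizukiFrdII2008, Def 3.1 (ii) p.23] -/
@[simp] theorem coe_expUnit (θ : ℝ) : ((expUnit θ : ℂˣ) : ℂ) = exp (θ * I) := rfl

/-- `θ ↦ e^{iθ}` is continuous into `ℂ^×` (both `e^{iθ}` and its inverse `e^{-iθ}` vary continuously).
[cite: MochizukiFrdII2008, Def 3.1 (ii) p.23] -/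
theorem continuous_expUnits : Continuous expUnits := by
  rw [Units.continuous_iff]
  constructor
  · change Continuous fun θ : ℝ => exp (θ * I)
    fun_prop
  · have h : (fun θ : ℝ => ((expUnits θ)⁻¹ : ℂˣ).val) = fun θ : ℝ => exp (-(θ * I)) := by
      funext θ
      rw [Units.val_inv_eq_inv_val, coe_expUnits, exp_neg]
    rw [h]
    fun_prop

/-- `θ ↦ e^{iθ}` is continuous into `O_ℂ^×`. [cite: MochizukiFrdII2008, Def 3.1 (ii) p.23] -/
theorem continuous_expUnit : Continuous expUnit :=
  continuous_expUnits.subtype_mk _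

/-- Every unit of norm `1` is `e^{iθ}` for `θ = arg` ∈ `(−π, π]`. [cite: MochizukiFrdII2008, Def 3.1 (ii) p.23] -/
theorem expUnit_arg (z : normOneSubgroup ℂ) : expUnit (arg ((z : ℂˣ) : ℂ)) = z := by
  apply Subtype.ext
  apply Units.ext
  rw [coe_expUnit]
  have h := norm_mul_exp_arg_mul_I ((z : ℂˣ) : ℂ)
  rw [(mem_normOneSubgroup_iff ℂ _).mp z.2, ofReal_one, one_mul] at h
  exact h

/-- `θ ↦ e^{iθ}` is surjective onto `O_ℂ^×`. [cite: MochizukiFrdII2008, Def 3.1 (ii) p.23] -/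
theorem expUnit_surjective : Function.Surjective expUnit := fun z => ⟨_, expUnit_arg z⟩

/-- `O_ℂ^× = S¹` is connected (a continuous image of `ℝ`). [cite: MochizukiFrdII2008, Def 3.1 (iii) p.24] -/
instance connectedSpace_normOneSubgroup : ConnectedSpace (normOneSubgroup ℂ) where
  isPreconnected_univ := by
    rw [← Set.image_univ_of_surjective expUnit_surjective]
    exact isPreconnected_univ.image _ continuous_expUnit.continuousOn
  toNonempty := ⟨1⟩

/-- In `O_ℂ^×` every connected component is everything. [cite: MochizukiFrdII2008, Def 3.1 (iii) p.24] -/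
theorem connectedComponent_eq_univ' (z : normOneSubgroup ℂ) : connectedComponent z = Set.univ :=
  PreconnectedSpace.connectedComponent_eq_univ z

/-! ### The arc `S¹ ∖ {−1}` -/

/-- `−1 ∈ O_ℂ^×`. [cite: MochizukiFrdII2008, Ex 3.3 (v) p.29] -/
def negOneUnit : normOneSubgroup ℂ := ⟨-1, by rw [mem_normOneSubgroup_iff]; simp⟩

/-- The value of `negOneUnit`. [cite: MochizukiFrdII2008, Ex 3.3 (v) p.29] -/
@[simp] theorem coe_negOneUnit : ((negOneUnit : ℂˣ) : ℂ) = -1 := rfl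

/-- For `θ ∈ (−π, π]`, `arg e^{iθ} = θ`. [cite: MochizukiFrdII2008, Def 3.1 (ii) p.23] -/
theorem arg_coe_expUnit {θ : ℝ} (hθ : θ ∈ Set.Ioc (-Real.pi) Real.pi) :
    arg ((expUnit θ : ℂˣ) : ℂ) = θ := by
  rw [coe_expUnit, exp_mul_I]
  exact arg_cos_add_sin_mul_I hθ

/-- The arc `S¹ ∖ {−1}` is the image of the open interval `(−π, π)` under `θ ↦ e^{iθ}`.
[cite: MochizukiFrdII2008, Ex 3.3 (v) p.29] -/
theorem image_expUnit_Ioo : expUnit '' Set.Ioo (-Real.pi) Real.pi = {z | z ≠ negOneUnit} := by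
  ext z
  constructor
  · rintro ⟨θ, hθ, rfl⟩ h
    have harg := arg_coe_expUnit ⟨hθ.1, hθ.2.le⟩
    rw [h, coe_negOneUnit, arg_neg_one] at harg
    exact absurd harg (ne_of_gt hθ.2)
  · intro hz
    refine ⟨arg ((z : ℂˣ) : ℂ), ⟨(arg_mem_Ioc _).1, lt_of_le_of_ne (arg_mem_Ioc _).2 ?_⟩,
      expUnit_arg z⟩
    intro hpi
    apply hz
    have h := expUnit_arg z
    rw [hpi] at h
    rw [← h]
    apply Subtype.ext; apply Units.ext
    rw [coe_expUnit, coe_negOneUnit]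
    exact_mod_cast exp_pi_mul_I

/-- The arc `S¹ ∖ {−1}` is connected. [cite: MochizukiFrdII2008, Ex 3.3 (v) p.29] -/
theorem isConnected_ne_negOneUnit : IsConnected {z : normOneSubgroup ℂ | z ≠ negOneUnit} := by
  rw [← image_expUnit_Ioo]
  exact (isConnected_Ioo (by linarith [Real.pi_pos] : -Real.pi < Real.pi)).image _
    continuous_expUnit.continuousOn

/-- The arc `S¹ ∖ {−1}` is open. [cite: MochizukiFrdII2008, Ex 3.3 (v) p.29] -/
theorem isOpen_ne_negOneUnit : IsOpen {z : normOneSubgroup ℂ | z ≠ negOneUnit} :=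
  isOpen_compl_singleton

/-! ### The slit region -/

/-- The **slit region** of tip `t`: the angular region of `ℂ^×` "determined by the complement in `S¹`
of a single element of `S¹`" (here `−1`), `A = (S¹ ∖ {−1}) × (0, t]` (FrdII Ex. 3.3 (v), p. 29; an
angular region in the sense of Def. 3.1 (iii): open, and its trace on the unique connected component
`S¹` is nonempty and connected). [cite: MochizukiFrdII2008, Ex 3.3 (v) p.29] -/
def slitRegion (t : PosReal) : AngularRegion ℂ where
  dir := {z | z ≠ negOneUnit}
  tip := t
  isOpen_dir := isOpen_ne_negOneUnit
  isConnected_inter z := by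
    rw [connectedComponent_eq_univ' z, Set.inter_univ]
    exact isConnected_ne_negOneUnit

/-- The angular part of the slit region. [cite: MochizukiFrdII2008, Ex 3.3 (v) p.29] -/
@[simp] theorem slitRegion_dir (t : PosReal) : (slitRegion t).dir = {z | z ≠ negOneUnit} := rfl

/-- The tip of the slit region. [cite: MochizukiFrdII2008, Ex 3.3 (v) p.29] -/
@[simp] theorem slitRegion_tip (t : PosReal) : (slitRegion t).tip = t := rfl

/-- Membership in the angular part of the slit region, in `ℂ`: `z ≠ −1`.
[cite: MochizukiFrdII2008, Ex 3.3 (v) p.29] -/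
theorem mem_slitRegion_dir_iff (t : PosReal) (z : normOneSubgroup ℂ) :
    z ∈ (slitRegion t).dir ↔ ((z : ℂˣ) : ℂ) ≠ -1 := by
  rw [slitRegion_dir, Set.mem_setOf_eq, not_iff_not]
  constructor
  · rintro rfl; rfl
  · intro h
    apply Subtype.ext; apply Units.ext
    rw [h, coe_negOneUnit]

/-- The slit region is NOT isotropic (`−1` is missing). [cite: MochizukiFrdII2008, Ex 3.3 (v) p.29] -/
theorem not_isIsotropic_slitRegion (t : PosReal) : ¬ (slitRegion t).IsIsotropic := by
  intro h
  have hmem : negOneUnit ∈ (slitRegion t).dir := by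
    rw [show (slitRegion t).dir = Set.univ from h]; trivial
  exact hmem rfl

end ArchFrd

end

end Literature.AlgebraicGeometry.Frobenioids
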